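import Literature.Barriers.SmoothPoincare4.CircleActionsStandard
import Literature.Topology.FourManifolds.SPC4Wave0
import Mathlib.Analysis.InnerProductSpace.Calculus
import HarnessLib

/-!
# Barrier (SmoothPoincare4): homotopy 4-spheres with a circle action are standard — proofs companion

Sibling of `Literature/Barriers/SmoothPoincare4/CircleActionsStandard.lean` (theorems only).

The barrier file renders the technique class "an exotic 4-sphere with a smooth effective circle
action" as `Literature.Barriers.SmoothPoincare4.ExoticSphereWithCircleActionFour`, vendors the
Fintushel–Pao theorem (smooth reading) as the named fact
`Literature.Barriers.SmoothPoincare4.fintushelPao_circleAction_homotopySphere_four`, and proves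
the barrier — catalogue name `CircleActionBarrierFour`, statement
`¬ ExoticSphereWithCircleActionFour` ("no exotic 4-sphere carries a smooth effective circle
action") — from it (`circleActionBarrierFour_of_fintushelPao`). This file works with the
barrier's STATEMENT `¬ ExoticSphereWithCircleActionFour` throughout — so that nothing here
depends on how the catalogue name is declared (D-0026 review 2026-08-15: the barrier is a
theorem relative to that one named fact, not a named fact of its own) — and closes the relation
up; the theorem names keep the barrier's catalogue name `circleActionBarrierFour…`:

* `exoticSphereWithCircleActionFour_iff_not_fintushelPao`,
  `circleActionBarrierFour_iff_fintushelPao`: the barrier statement is *equivalent* to the named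
  fact (`¬ ExoticSphereWithCircleActionFour ↔ fintushelPao_circleAction_homotopySphere_four`), so
  an unconditional proof of the barrier statement is exactly a formal proof of the
  Fintushel–Pao–Perelman theorem, and a proof of the technique class would be a disproof of it;
  the trust base of the barrier is exactly {`fintushelPao_circleAction_homotopySphere_four`}, and
  the barrier is not a second census entry for the same printed theorem.
* `circleActionBarrierFour_of_smoothPoincare`,
  `ExoticSphereWithCircleActionFour.existsExoticFourSphere`,
  `circleActionBarrierFour_of_not_existsExoticFourSphere`: the barrier statement is implied by
  the conjecture it guards (Mathlib form of `SmoothPoincare4`; and, through Freedman's theorem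
  `Literature.Topology.FourManifolds.nonempty_homeomorph_sphere_four`, the flag form
  `¬ Literature.Topology.FourManifolds.ExistsExoticFourSphere`) — the `blocks:` line of the
  barrier made formal: an inhabitant of the technique class is an exotic 4-sphere.

* `LinearCircleActionFour.*`, `exists_smooth_faithful_circleAction_homotopySphere_four`
  (PROVED, Mathlib only): the standard `S⁴ ⊂ ℝ⁵` with the linear circle action rotating the
  `(x₀, x₁)`-plane is a closed smooth 4-manifold `≃ₕ S⁴` whose action is smooth
  (`ContMDiffSMul (𝓡 1) (𝓡 4) ∞`), effective (`FaithfulSMul`), semifree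
  (`stabilizer_eq_bot_or_eq_top`) with fixed-point set the great 2-sphere `{x₀ = x₁ = 0}`
  (`fixedPoints_eq`; Fintushel's orbit type `F = S²`, `E = ∅`, orbit space `D³` — Pao's linear
  action `M(D³)`, Pao 1978 Thm. 4), and which is `≃ₘ S⁴`. This is the technique class
  `ExoticSphereWithCircleActionFour` with its last clause `IsEmpty (M ≃ₘ S⁴)` flipped to
  `Nonempty`: every hypothesis of the named fact is realised, so neither the fact nor the barrier
  is vacuously true in the tree's rendering, and the technique class is cut out by the
  diffeomorphism type alone.

## Why the fact is not discharged here (provefact triage `XL`)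

The printed proof of the named fact runs: (1) for an effective locally smooth `S¹`-action on a
homotopy 4-sphere `M` the fixed set is `S²` or two points and the orbit space `M*` is a homotopy
3-disc (then there are no exceptional orbits) or a homotopy 3-sphere (Pao 1978 §1 (1), after
Fintushel 1976; Fintushel 1977 Prop. 3.1 for simply connected `M`: slice theorem, local orbit
structure, `χ(F) = 2 + rank H₂(M)`); (2) Fintushel's equivariant classification of such actions
by orbit data `{M*}, {M*, n}, {(M*, K); m, n}` (Fintushel 1976, quoted in Pao 1978 §1);
(3) Pao's replacement trick — change the action on an invariant tubular neighbourhood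
`D² × S²` of the 2-sphere `Eₙ ∪ F` and reglue by a map isotopic to the identity, so the manifold
is unchanged while `(m, n)` descends Euclidean-algorithm style to `(1, 1)` or `(1, 0)` (Pao 1978
Prop. 2 and Thm. 3: at most two homotopy 4-spheres with circle action per homotopy 3-sphere
`Σ`, with orbit spaces `Σ` and `Σ − Int D³`); (4) `M(D³) = M(S³) = S⁴`, linear actions (Pao 1978
Thm. 4, after Fintushel 1976); (5) Perelman: `Σ = S³`. None of (1)–(4) has infrastructure in
Mathlib or Literature (no manifold structure on orbit spaces of compact group actions, no slice
theorem, no equivariant tubular neighbourhoods, no Smith theory), and (5) is a theory of its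
own (the tree carries it as the named facts
`Literature.Topology.FourManifolds.nonempty_homeomorph_sphere_three` /
`nonempty_diffeomorph_sphere_three`). The sources print the result "modulo the 3-dimensional
Poincaré conjecture" (Fintushel 1978 §13 and Thm. 13.2; Pao 1978, abstract: "if the
3-dimensional Poincaré conjecture is true, these actions plus the linear ones are the only
possible circle actions on `S⁴`"), in the locally smooth category with conclusions up to
(equivariant) homeomorphism; the purely topological chain (1)–(5) would only yield
"homeomorphic to `S⁴`", which Freedman's theorem gives without any action, while the
diffeomorphism conclusion for smooth actions is printed only in Edmonds' update of Problem 27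
("The answer is yes by the early work of Fintushel and the positive resolution of the classical
Poincaré Conjecture by Perelman"). Hence the only faithful coarse decomposition of the smooth
statement is {Fintushel–Pao modulo Poincaré (Edmonds' reading), Perelman}; under the fact
discipline (D-0026) the first member is not minted here as a further unproved fact — it is
recorded in prose only, and the barrier keeps the single named fact of the barrier file as its
trust base.

## References

[Fintushel1978] [Fintushel1977] [Fintushel1976] [Pao1978] [Edmonds2009Survey] [Perelman2002]
[Freedman1982] (Fintushel 1976, Duke Math. J. 43, is paywalled and was not read; its statements
are quoted from Pao 1978 §1 and Thm. 4.)
-/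

noncomputable section

open scoped Manifold ContDiff
open ContinuousMap

namespace Literature.Barriers.SmoothPoincare4

/-! ### The barrier statement is exactly the Fintushel–Pao fact -/

/-- **`ExoticSphereWithCircleActionFour` holds iff the Fintushel–Pao fact fails.** Forward: an
exotic symmetric homotopy 4-sphere is a counterexample to
`fintushelPao_circleAction_homotopySphere_four`. Backward: if the fact fails, some closed smooth
`M ≃ₕ S⁴` with a smooth effective `S¹`-action has no diffeomorphism to `S⁴`, i.e. witnesses the
technique class. In particular a proof of `ExoticSphereWithCircleActionFour` would be a
disproof of the Fintushel–Pao–Perelman theorem as rendered in the tree: the technique class is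
refuted, not open. [cite: Fintushel1978, Thm. 13.2 and §13] [cite: Edmonds2009Survey, §9 Problem 27] -/
theorem exoticSphereWithCircleActionFour_iff_not_fintushelPao :
    ExoticSphereWithCircleActionFour ↔ ¬ fintushelPao_circleAction_homotopySphere_four := by
  constructor
  · rintro ⟨M, _, _, _, _, _, _, _, hF, hS, hH, hE⟩ hFP
    exact hE.false (hFP M hF hS hH).some
  · intro hFP
    by_contra hE
    apply hFP
    intro M _ _ _ _ _ _ _ hF hS hH
    by_contra hN
    exact hE ⟨M, inferInstance, inferInstance, inferInstance, inferInstance, inferInstance,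
      inferInstance, inferInstance, hF, hS, hH, not_nonempty_iff.mp hN⟩

/-- **The barrier statement is equivalent to the Fintushel–Pao fact**:
`¬ ExoticSphereWithCircleActionFour ↔ fintushelPao_circleAction_homotopySphere_four` (the
left-hand side is the statement of the catalogued barrier `CircleActionBarrierFour`). Hence,
relative to Literature, an unconditional proof of the barrier statement is exactly a formal proof
of "every homotopy 4-sphere with a smooth effective circle action is diffeomorphic to `S⁴`", which
is why the barrier is a theorem relative to the named fact and not a named fact of its own
(D-0026). [cite: Fintushel1978, Thm. 13.2 and §13] [cite: Edmonds2009Survey, §9 Problem 27] -/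
theorem circleActionBarrierFour_iff_fintushelPao :
    ¬ ExoticSphereWithCircleActionFour ↔ fintushelPao_circleAction_homotopySphere_four := by
  rw [exoticSphereWithCircleActionFour_iff_not_fintushelPao, not_not]

/-! ### The barrier statement is implied by the conjecture it guards -/

/-- **`SmoothPoincare4` (Mathlib form) implies the barrier statement.** If every Hausdorff
second countable smooth 4-manifold homotopy equivalent to `S⁴` is diffeomorphic to `S⁴`
(`ContinuousMap.HomotopyEquiv.NonemptyDiffeomorphSphere M 4` for all such `M`, the shape of
`Summits/SmoothPoincare4/SmoothPoincare4/Statement.lean`), then no exotic 4-sphere with a circle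
action exists. Contrapositive of `ExoticSphereWithCircleActionFour.not_smoothPoincare`.
[cite: Edmonds2009Survey, §9 Problem 27] -/
theorem circleActionBarrierFour_of_smoothPoincare
    (hS : ∀ (M : Type) [TopologicalSpace M] [T2Space M] [SecondCountableTopology M],
      HomotopyEquiv.NonemptyDiffeomorphSphere M 4) :
    ¬ ExoticSphereWithCircleActionFour :=
  fun hE => hE.not_smoothPoincare hS

/-- **An inhabitant of the technique class is an exotic 4-sphere** (the `blocks:` line of the
barrier, formally): given Freedman's theorem in the tree's form
`Literature.Topology.FourManifolds.nonempty_homeomorph_sphere_four` (a Hausdorff second countable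
topological 4-manifold `≃ₕ S⁴` is `≃ₜ S⁴`), an exotic 4-sphere with a circle action yields the
flag `Literature.Topology.FourManifolds.ExistsExoticFourSphere` (a smooth 4-manifold
homeomorphic but not diffeomorphic to `S⁴`), forgetting the action.
[cite: Freedman1982, Thm 1.6] [cite: Edmonds2009Survey, §9 Problem 27] -/
theorem ExoticSphereWithCircleActionFour.existsExoticFourSphere
    (h : ExoticSphereWithCircleActionFour)
    (hFr : Literature.Topology.FourManifolds.nonempty_homeomorph_sphere_four.{0}) :
    Literature.Topology.FourManifolds.ExistsExoticFourSphere := by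
  obtain ⟨M, _, _, _, _, _, _, _, -, -, ⟨e⟩, hE⟩ := h
  obtain ⟨φ⟩ := hFr M e
  exact ⟨M, inferInstance, inferInstance, inferInstance, φ, hE⟩

/-- **The flag form of `SmoothPoincare4` implies the barrier statement**: if there is no exotic
4-sphere (`¬ Literature.Topology.FourManifolds.ExistsExoticFourSphere`) then, given Freedman's
theorem (`Literature.Topology.FourManifolds.nonempty_homeomorph_sphere_four`), there is none with a
circle action either. [cite: Freedman1982, Thm 1.6] [cite: Edmonds2009Survey, §9 Problem 27] -/
theorem circleActionBarrierFour_of_not_existsExoticFourSphere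
    (hFr : Literature.Topology.FourManifolds.nonempty_homeomorph_sphere_four.{0})
    (hS : ¬ Literature.Topology.FourManifolds.ExistsExoticFourSphere) :
    ¬ ExoticSphereWithCircleActionFour :=
  fun hE => hS (hE.existsExoticFourSphere hFr)

/-! ### Non-vacuity: the linear circle action on the standard `S⁴`

The hypotheses of `fintushelPao_circleAction_homotopySphere_four` — a closed smooth 4-manifold
`≃ₕ S⁴` with a smooth effective `Circle`-action, in Mathlib's vocabulary — are realised by the
round `S⁴ ⊂ ℝ⁵` with `S¹ ⊂ ℂ` acting by complex multiplication on the `(x₀, x₁)`-plane. This is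
the simplest of the "linear actions" of Pao 1978, Thm. 4 (`M(D³) = S⁴`: fixed set `S²`, no
exceptional orbits, orbit space `D³`); we certify smoothness, effectiveness, the fixed-point set
and semifreeness, all from Mathlib. [cite: Pao1978, Thm. 4] [cite: Fintushel1977, §2–3] -/

/-- Local notation: `𝔼 n` is the model Euclidean space `EuclideanSpace ℝ (Fin n)`. -/
local notation "𝔼 " n:arg => EuclideanSpace ℝ (Fin n)

/-- Local notation: `𝕊 n` is the unit sphere in `EuclideanSpace ℝ (Fin (n + 1))`. -/
local notation "𝕊 " n:arg => (Metric.sphere (0 : EuclideanSpace ℝ (Fin (n + 1))) 1)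

namespace LinearCircleActionFour

/-- The linear map of `ℝ⁵` given by complex multiplication by `t` on the `(x₀, x₁)`-plane
(a rotation when `‖t‖ = 1`) and the identity on `x₂, x₃, x₄`; for `t ∈ S¹` these are the
rotations of the simplest linear circle action on `S⁴` (Pao's `M(D³)`). [cite: Pao1978, Thm. 4] -/
def rot (t : ℂ) (x : 𝔼 5) : 𝔼 5 :=
  WithLp.toLp 2 ![t.re * x 0 - t.im * x 1, t.im * x 0 + t.re * x 1, x 2, x 3, x 4]

/-- Coordinate `0` of `rot t x`. [folklore] -/
@[simp] lemma rot_apply_zero (t : ℂ) (x : 𝔼 5) : rot t x 0 = t.re * x 0 - t.im * x 1 := rfl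
/-- Coordinate `1` of `rot t x`. [folklore] -/
@[simp] lemma rot_apply_one (t : ℂ) (x : 𝔼 5) : rot t x 1 = t.im * x 0 + t.re * x 1 := rfl
/-- Coordinate `2` of `rot t x`. [folklore] -/
@[simp] lemma rot_apply_two (t : ℂ) (x : 𝔼 5) : rot t x 2 = x 2 := rfl
/-- Coordinate `3` of `rot t x`. [folklore] -/
@[simp] lemma rot_apply_three (t : ℂ) (x : 𝔼 5) : rot t x 3 = x 3 := rfl
/-- Coordinate `4` of `rot t x`. [folklore] -/
@[simp] lemma rot_apply_four (t : ℂ) (x : 𝔼 5) : rot t x 4 = x 4 := rfl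

/-- `rot 1` is the identity. [folklore] -/
lemma rot_one (x : 𝔼 5) : rot 1 x = x := by
  ext i; fin_cases i <;> simp

/-- `rot` is multiplicative in `t ∈ ℂ` (complex multiplication on the `(x₀, x₁)`-plane).
[folklore] -/
lemma rot_mul (s t : ℂ) (x : 𝔼 5) : rot (s * t) x = rot s (rot t x) := by
  ext i; fin_cases i <;> simp <;> ring

/-- `‖rot t x‖² = |t|² (x₀² + x₁²) + (x₂² + x₃² + x₄²)`. [folklore] -/
lemma norm_sq_rot (t : ℂ) (x : 𝔼 5) :
    ‖rot t x‖ ^ 2 = Complex.normSq t * (x 0 ^ 2 + x 1 ^ 2) + (x 2 ^ 2 + x 3 ^ 2 + x 4 ^ 2) := by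
  rw [EuclideanSpace.real_norm_sq_eq, Fin.sum_univ_five, Complex.normSq_apply]
  simp only [rot_apply_zero, rot_apply_one, rot_apply_two, rot_apply_three, rot_apply_four]
  ring

/-- `rot t` preserves the norm for `t ∈ S¹`. [folklore] -/
lemma norm_rot (t : Circle) (x : 𝔼 5) : ‖rot t x‖ = ‖x‖ := by
  have h : ‖rot t x‖ ^ 2 = ‖x‖ ^ 2 := by
    rw [norm_sq_rot, EuclideanSpace.real_norm_sq_eq x, Fin.sum_univ_five, Circle.normSq_coe,
      one_mul]
    ring
  exact (sq_eq_sq₀ (norm_nonneg _) (norm_nonneg _)).1 h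

/-- `rot t` preserves the unit sphere `S⁴` for `t ∈ S¹`. [folklore] -/
lemma rot_mem_sphere (t : Circle) (x : 𝕊 4) : rot t x ∈ 𝕊 4 := by
  rw [mem_sphere_zero_iff_norm, norm_rot]
  exact mem_sphere_zero_iff_norm.1 x.2

/-- `rot` is smooth as a map `ℂ × ℝ⁵ → ℝ⁵` (it is real bilinear). [folklore] -/
lemma contDiff_rot : ContDiff ℝ ∞ (fun p : ℂ × 𝔼 5 => rot p.1 p.2) := by
  have hre : ContDiff ℝ ∞ fun p : ℂ × 𝔼 5 => p.1.re :=
    Complex.reCLM.contDiff.comp contDiff_fst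
  have him : ContDiff ℝ ∞ fun p : ℂ × 𝔼 5 => p.1.im :=
    Complex.imCLM.contDiff.comp contDiff_fst
  have hx : ∀ j, ContDiff ℝ ∞ fun p : ℂ × 𝔼 5 => p.2 j := fun j =>
    (contDiff_euclidean (f := fun p : ℂ × 𝔼 5 => p.2)).1 contDiff_snd j
  rw [contDiff_euclidean]
  intro i
  fin_cases i
  · exact (hre.mul (hx 0)).sub (him.mul (hx 1))
  · exact (him.mul (hx 0)).add (hre.mul (hx 1))
  · exact hx 2
  · exact hx 3
  · exact hx 4

/-- The linear circle action on `S⁴`: `t ∈ S¹ ⊂ ℂ` rotates the `(x₀, x₁)`-plane (Pao's linear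
action `M(D³)`; a local instance in this section only). [cite: Pao1978, Thm. 4] -/
@[reducible] def mulAction : MulAction Circle (𝕊 4) where
  smul t x := ⟨rot t x, rot_mem_sphere t x⟩
  one_smul x := Subtype.ext (by
    change rot ((1 : Circle) : ℂ) x = x
    rw [Circle.coe_one, rot_one])
  mul_smul s t x := Subtype.ext (by
    change rot ((s * t : Circle) : ℂ) x = rot s (rot t x)
    rw [Circle.coe_mul, rot_mul])

attribute [local instance] mulAction

/-- Unfolding the linear action. [folklore] -/
lemma smul_def (t : Circle) (x : 𝕊 4) : t • x = ⟨rot t x, rot_mem_sphere t x⟩ := rfl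

/-- The linear action seen in `ℝ⁵` is `rot`. [folklore] -/
@[simp] lemma coe_smul (t : Circle) (x : 𝕊 4) : ((t • x : 𝕊 4) : 𝔼 5) = rot t x := rfl

/-- The linear action is effective (`t` is recovered from `t • e₀ = (Re t, Im t, 0, 0, 0)`).
[folklore] -/
lemma faithfulSMul : FaithfulSMul Circle (𝕊 4) := by
  refine ⟨fun {s t} h => ?_⟩
  have he : (EuclideanSpace.single 0 1 : 𝔼 5) ∈ 𝕊 4 := by simp
  have h0 := congrArg (fun y : 𝕊 4 => (y : 𝔼 5) 0) (h ⟨_, he⟩)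
  have h1 := congrArg (fun y : 𝕊 4 => (y : 𝔼 5) 1) (h ⟨_, he⟩)
  simp at h0 h1
  exact Circle.ext (Complex.ext h0 h1)

/-- A point of `S⁴` fixed by the half-turn `-1 ∈ S¹` has `x₀ = x₁ = 0`. [folklore] -/
lemma apply_eq_zero_of_neg_one_smul {x : 𝕊 4} (h : (-1 : Circle) • x = x) :
    (x : 𝔼 5) 0 = 0 ∧ (x : 𝔼 5) 1 = 0 := by
  have h0 := congrArg (fun y : 𝕊 4 => (y : 𝔼 5) 0) h
  have h1 := congrArg (fun y : 𝕊 4 => (y : 𝔼 5) 1) h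
  simp at h0 h1
  constructor <;> linarith

/-- **Fixed-point set `F = S²`.** The fixed points of the linear action are exactly the points of
`S⁴` with `x₀ = x₁ = 0`, a great 2-sphere (Fintushel's case `F = S²`, no exceptional orbits,
orbit space `D³`: the linear action `M(D³)` of Pao). [cite: Pao1978, Thm. 4 and §1 (1)] -/
lemma fixedPoints_eq :
    MulAction.fixedPoints Circle (𝕊 4) = {x : 𝕊 4 | (x : 𝔼 5) 0 = 0 ∧ (x : 𝔼 5) 1 = 0} := by
  ext x
  refine ⟨fun hx => apply_eq_zero_of_neg_one_smul (hx (-1)), ?_⟩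
  rintro ⟨h0, h1⟩ t
  apply Subtype.ext
  ext i
  fin_cases i <;> simp [h0, h1]

/-- **The linear action is semifree**: an element of `S¹` fixing a point off the 2-sphere
`{x₀ = x₁ = 0}` is the identity (no exceptional orbits, `E = ∅`). [folklore] -/
lemma eq_one_of_smul_eq {t : Circle} {x : 𝕊 4} (h : t • x = x)
    (hx : ¬ ((x : 𝔼 5) 0 = 0 ∧ (x : 𝔼 5) 1 = 0)) : t = 1 := by
  have h0 := congrArg (fun y : 𝕊 4 => (y : 𝔼 5) 0) h
  have h1 := congrArg (fun y : 𝕊 4 => (y : 𝔼 5) 1) h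
  simp only [coe_smul, rot_apply_zero, rot_apply_one] at h0 h1
  have hn : (t : ℂ).re * (t : ℂ).re + (t : ℂ).im * (t : ℂ).im = 1 := by
    rw [← Complex.normSq_apply]; exact Circle.normSq_coe t
  have key : ((t : ℂ).re - 1) * ((x : 𝔼 5) 0 ^ 2 + (x : 𝔼 5) 1 ^ 2) = 0 := by
    linear_combination (x : 𝔼 5) 0 * h0 + (x : 𝔼 5) 1 * h1
  have hpos : (x : 𝔼 5) 0 ^ 2 + (x : 𝔼 5) 1 ^ 2 ≠ 0 := by
    intro h0'
    apply hx
    constructor <;> nlinarith [sq_nonneg ((x : 𝔼 5) 0), sq_nonneg ((x : 𝔼 5) 1)]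
  have hre : (t : ℂ).re = 1 := by
    have := (mul_eq_zero.1 key).resolve_right hpos
    linarith
  have him : (t : ℂ).im = 0 := by
    rw [hre] at hn
    nlinarith [sq_nonneg ((t : ℂ).im)]
  exact Circle.ext (Complex.ext (by simpa using hre) (by simpa using him))

/-- **Orbit types**: every isotropy group of the linear action is trivial or all of `S¹`
(principal orbits and fixed points only; no exceptional orbits). [folklore] -/
lemma stabilizer_eq_bot_or_eq_top (x : 𝕊 4) :
    MulAction.stabilizer Circle x = ⊥ ∨ MulAction.stabilizer Circle x = ⊤ := by
  by_cases hx : (x : 𝔼 5) 0 = 0 ∧ (x : 𝔼 5) 1 = 0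
  · right
    rw [eq_top_iff]
    intro t _
    have hfix : x ∈ MulAction.fixedPoints Circle (𝕊 4) := by rw [fixedPoints_eq]; exact hx
    exact hfix t
  · left
    rw [eq_bot_iff]
    intro t ht
    exact eq_one_of_smul_eq ht hx

/-- `rot` is `C^∞` as a map of manifolds `ℂ × ℝ⁵ → ℝ⁵` (product model). [folklore] -/
lemma contMDiff_rot :
    ContMDiff (𝓘(ℝ, ℂ).prod 𝓘(ℝ, 𝔼 5)) 𝓘(ℝ, 𝔼 5) ∞ (fun p : ℂ × 𝔼 5 => rot p.1 p.2) := by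
  rw [← modelWithCornersSelf_prod, chartedSpaceSelf_prod]
  exact contDiff_rot.contMDiff

-- `finrank ℝ ℂ = 1 + 1`: the instance under which `Circle` is a charted space in Mathlib.
attribute [local instance] finrank_real_complex_fact'

/-- `finrank ℝ ℝ⁵ = 4 + 1`, the instance under which `S⁴` is a charted space in Mathlib.
[folklore] -/
theorem fact_finrank_euclideanSpace_five : Fact (Module.finrank ℝ (𝔼 5) = 4 + 1) :=
  ⟨finrank_euclideanSpace_fin⟩

attribute [local instance] fact_finrank_euclideanSpace_five

/-- The inclusion `S¹ × S⁴ → ℂ × ℝ⁵` is `C^∞`. [folklore] -/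
lemma contMDiff_coe_prod :
    ContMDiff ((𝓡 1).prod (𝓡 4)) (𝓘(ℝ, ℂ).prod 𝓘(ℝ, 𝔼 5)) ∞
      (fun p : Circle × 𝕊 4 => ((p.1 : ℂ), (p.2 : 𝔼 5))) := by
  let c : Circle → ℂ := (↑)
  let d : 𝕊 4 → 𝔼 5 := (↑)
  have h : ContMDiff ((𝓡 1).prod (𝓡 4)) (𝓘(ℝ, ℂ).prod 𝓘(ℝ, 𝔼 5)) ∞ (Prod.map c d) := by
    apply ContMDiff.prodMap <;> exact contMDiff_coe_sphere
  exact h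

/-- The action map followed by the inclusion, `S¹ × S⁴ → ℝ⁵`, is `C^∞`. [folklore] -/
lemma contMDiff_rot_coe :
    ContMDiff ((𝓡 1).prod (𝓡 4)) 𝓘(ℝ, 𝔼 5) ∞ (fun p : Circle × 𝕊 4 => rot p.1 p.2) :=
  contMDiff_rot.comp contMDiff_coe_prod

/-- The linear action is smooth (`C^∞` as a map `S¹ × S⁴ → S⁴`). [folklore] -/
lemma contMDiffSMul : ContMDiffSMul (𝓡 1) (𝓡 4) ∞ Circle (𝕊 4) where
  contMDiff_smul := by
    show ContMDiff ((𝓡 1).prod (𝓡 4)) (𝓡 4) ∞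
      (fun p : Circle × 𝕊 4 => (⟨rot p.1 p.2, rot_mem_sphere p.1 p.2⟩ : 𝕊 4))
    exact contMDiff_rot_coe.codRestrict_sphere (fun p => rot_mem_sphere p.1 p.2)

end LinearCircleActionFour

/-- **Non-vacuity: every clause of the technique class except exoticness is realised.** This is
`ExoticSphereWithCircleActionFour` with its last conjunct `IsEmpty (M ≃ₘ S⁴)` replaced by
`Nonempty (M ≃ₘ S⁴)`, witnessed by the standard `S⁴` with the linear circle action
`LinearCircleActionFour.mulAction`: a closed smooth 4-manifold (Hausdorff, second countable,
compact, `C^∞` on `ℝ⁴`, in `Type`) `≃ₕ S⁴` with a smooth (`ContMDiffSMul (𝓡 1) (𝓡 4) ∞`) and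
effective (`FaithfulSMul`) action of `Circle`. Hence the hypotheses of
`fintushelPao_circleAction_homotopySphere_four` are jointly satisfiable in the tree's rendering
(neither the named fact nor `CircleActionBarrierFour` is vacuously true), and an inhabitant of the
technique class could differ from this example only in its diffeomorphism type.
[cite: Pao1978, Thm. 4] [cite: Edmonds2009Survey, §9 Problem 27] -/
theorem exists_smooth_faithful_circleAction_homotopySphere_four :
    ∃ (M : Type) (_ : TopologicalSpace M) (_ : T2Space M) (_ : SecondCountableTopology M)
      (_ : ChartedSpace (𝔼 4) M) (_ : IsManifold (𝓡 4) ∞ M) (_ : CompactSpace M)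
      (_ : MulAction Circle M), FaithfulSMul Circle M ∧ ContMDiffSMul (𝓡 1) (𝓡 4) ∞ Circle M ∧
      Nonempty (M ≃ₕ 𝕊 4) ∧ Nonempty (M ≃ₘ⟮𝓡 4, 𝓡 4⟯ (𝕊 4)) :=
  ⟨𝕊 4, inferInstance, inferInstance, inferInstance, inferInstance, inferInstance, inferInstance,
    LinearCircleActionFour.mulAction, LinearCircleActionFour.faithfulSMul,
    LinearCircleActionFour.contMDiffSMul, ⟨.refl _⟩, ⟨Diffeomorph.refl (𝓡 4) (𝕊 4) ∞⟩⟩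

end Literature.Barriers.SmoothPoincare4

end
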